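import Mathlib
import Summits.Parity.GeneralizedHardyLittlewood.Theses.LeeYangFibres

/-! # Drefute probe for line `section-annihilator` (refuter-drefute-stmt-Parity-14109-0)
Copy of the skeleton's statements (namespace `…CellParityLaw.DrefuteProbe`, to avoid FQN clashes with the
skeleton) followed by `namespace Probe`: kernel-checked identities the Walsh step leans on
(`sectionMass_one_eq_cell`, `archFactor_removeNth`, `affLinSize_removeNth_le`, `isNondegenerateSystem_removeNth`,
`convex_halfBody`, `localFactor_fin0`, insertNth/removeNth conventions). The six `stub_*` keep their `sorry`. -/

/-!
# Line `section-annihilator` — skeleton for crux `LeeYangFibres.CellParityLaw` (stmt-Parity-14109)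

Idea (card `section-annihilator`, triage r1 X1/F5c): the cell tensor `C_j`, `j ∈ [1,u]^{t+1}`, of a
`(t+1)`-form system obeys the parity-vector law iff every COORDINATE SECTION
`m ↦ C_{(m, j')}` (one index free, the other `t` frozen) is PARITY-AFFINE in the model basis
`(a_m 1_{m odd}, a_m 1_{m even})`, `a_m = A_m(N)/N`, with the parity average pinned to the
fibre mass; the Walsh amplitudes are then assembled coordinate by coordinate (tensor
flattening + positivity ⇒ `|θ_S| ≤ 1 + o(1)`), and the fibre masses are joint cells of the
`t`-form subsystem over a half-body — induction on the number of forms.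

Each section `b(m) = #{n ∈ K ∩ ℤ : ψ_i(n) = m, ψ_k(n) ∈ cell j'_k (k ≠ i)}` is ONE sifted
sequence; Bombieri's asymptotic sieve (tree: `Bombieri1976_asymptotic_sieve_finiteLevel_holds`,
`Bombieri1976_asymptotic_sieve_vector_holds`, per sequence) turns a level-of-distribution
hypothesis for it (the open atom `stub_sectionLevel`, a typed tuple-GEH fragment with the
EXPLICIT rough-supported density `sectionDensity` — the repaired shape demanded by the negative
`PrimeDeterminantCellsConvMomentLevelOne_refuted`) into the one-parameter section law
(`stub_sectionBombieri`, the uniform/effective re-cut of the tree engine). Effective errors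
`N / (log N)^t (log log N)^B` (every `B`) are used between the layers: the absolute budget of the
crux demands relative accuracy `(log log N)^{-O(t)}` on systems with large singular product, and
`(log log N)^{-B}` sits strictly between the crux's `ε` and the refuted extra `log`
(`cellParityLaw_false_logSucc` in Disproof.lean).

Stubs (6): `stub_sectionLevel` (atom, open), `stub_sectionBombieri` (engine, XL),
`stub_modelDensityBounds` (anatomy of rough integers, M), `stub_singularRatio` (singular-series
bookkeeping, M), `stub_walshStep` (tensor/Walsh assembly = the induction step, L),
`stub_base` (`t = 1`: one progression segment, L). Composition: `lawEffAt_all` (pure logic over the six stub statements: induction on `t`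
from `t = 1`) and `CellParityLaw_of : CellParityLaw` (= `lawEffAt_all` of the six stubs, then
`(log log N)^{-1} ≤ ε`), both proved; no `Prop` hypotheses on the concluding theorem (A12 audit shape).
-/

noncomputable section

open scoped BigOperators Classical
open Finset Literature.NumberTheory.Sieve

namespace Summit.Parity.GeneralizedHardyLittlewood.Cruxes.CellParityLaw.DrefuteProbe

/-! ## Abbreviations (the crux's own inlined objects; nothing new is posited) -/

/-- The joint rough `Ω`-cell count `C_j(Ψ, K, N, u)` — VERBATIM the filtered count of
`LeeYangFibres.CellParityLaw`: lattice points `n ∈ [-N,N] ∩ K` with `P⁻(ψ_i(n)) > N^{1/u}` and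
`Ω(ψ_i(n)) = j_i` for every form. -/
def cell {t : ℕ} (Ψ : Fin t → AffLinForm 1) (K : Set (Fin 1 → ℝ)) (N u : ℕ) (j : Fin t → ℕ) : ℕ :=
  ((latticeBox 1 N).filter (fun n => realPoint n ∈ K ∧ ∀ i,
      (N : ℝ) ^ ((1 : ℝ) / u) < (Nat.minFac ((Ψ i).eval n).toNat : ℝ) ∧
        ArithmeticFunction.cardFactors ((Ψ i).eval n).toNat = j i)).card

/-- The model cell density `a_m = A_m(N)/N`, `A_m(N) = #{n ≤ N : P⁻(n) > N^{1/u}, Ω(n) = m}` —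
VERBATIM the crux's model factor. (`a_u = 0` identically: `modelCell_top_eq_zero` of Disproof.lean.) -/
def modelDensity (N u m : ℕ) : ℝ :=
  ((((Finset.Icc 1 N).filter (fun n => (N : ℝ) ^ ((1 : ℝ) / u) < (Nat.minFac n : ℝ) ∧
      ArithmeticFunction.cardFactors n = m)).card : ℕ) : ℝ) / N

/-- The Walsh polynomial `W_θ(j) = ∑_S θ_S ∏_{i ∈ S} (-1)^{j_i + 1}` of the parity vector of `j` —
VERBATIM the crux's amplitude factor. -/
def walsh {t : ℕ} (θ : Finset (Fin t) → ℝ) (j : Fin t → ℕ) : ℝ :=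
  ∑ S : Finset (Fin t), θ S * ∏ i ∈ S, (-1 : ℝ) ^ (j i + 1)

/-- `ν_p(Ψ)`: the number of residues `c mod p` at which some form of the (one-dimensional)
system vanishes mod `p` (so `β_p(Ψ) = (1 - ν_p/p)(1 - 1/p)^{-t}` is the tree's `localFactor Ψ p`). -/
def zeroCount {s : ℕ} (Ψ : Fin s → AffLinForm 1) (p : ℕ) : ℕ :=
  ((Finset.range p).filter (fun c => ∃ k, (p : ℤ) ∣ (Ψ k).eval (fun _ => (c : ℤ)))).card

/-- The SECTION DENSITY `g_{Ψ,i}(d) = ∏_{p ∣ d} g_{Ψ,i}(p)` (used on square-free `d`), with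
`g_{Ψ,i}(p) = (ν_p(Ψ) - ν_p(Ψ₋ᵢ)) / (p - ν_p(Ψ₋ᵢ))`, `Ψ₋ᵢ = Fin.removeNth i Ψ`: the proportion,
among the residues `n mod p` allowed by `p ∤ ψ_k(n)` (`k ≠ i`), of those with `p ∣ ψ_i(n)`.
It is the exact telescoping factor of the singular series,
`(1 - g_{Ψ,i}(p)) · β_p(Ψ₋ᵢ) = (1 - 1/p) · β_p(Ψ)`, hence `∏_p (1 - g)(1 - 1/p)^{-1} = 𝔖(Ψ)/𝔖(Ψ₋ᵢ)`;
it is supported on the rough side (no secondary main term at small primes — the repair asked for by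
`PrimeDeterminantCellsConvMomentLevelOne_refuted`). Junk `x/0 = 0` only when `ν_p(Ψ₋ᵢ) = p`, where
every section is empty. -/
def sectionDensity {t : ℕ} (Ψ : Fin (t + 1) → AffLinForm 1) (i : Fin (t + 1)) (d : ℕ) : ℝ :=
  ∏ p ∈ d.primeFactors,
    ((zeroCount Ψ p : ℝ) - zeroCount (Fin.removeNth i Ψ) p) / ((p : ℝ) - zeroCount (Fin.removeNth i Ψ) p)

/-- The SECTION (fibre) MASS in the class `0 mod d`: lattice points `n ∈ [-N,N] ∩ K` with
`ψ_i(n) > 0`, `d ∣ ψ_i(n)`, and every OTHER form in its cell `j'_k` (`k : Fin t` indexes the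
forms `ψ_{i.succAbove k}`). `d = 1` is the total mass `F⁽ⁱ⁾_{j'}` of the section sequence
`b(m) = #{n : ψ_i(n) = m, others in cells}`; it equals the joint cell count of the `t`-form
subsystem `Fin.removeNth i Ψ` over the convex half-body `K ∩ {ψ_i > 0}`. -/
def sectionMass {t : ℕ} (Ψ : Fin (t + 1) → AffLinForm 1) (K : Set (Fin 1 → ℝ)) (N u : ℕ)
    (i : Fin (t + 1)) (j' : Fin t → ℕ) (d : ℕ) : ℕ :=
  ((latticeBox 1 N).filter (fun n => realPoint n ∈ K ∧ 0 < (Ψ i).eval n ∧ (d : ℤ) ∣ (Ψ i).eval n ∧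
      ∀ k : Fin t, (N : ℝ) ^ ((1 : ℝ) / u) < (Nat.minFac ((Ψ (i.succAbove k)).eval n).toNat : ℝ) ∧
        ArithmeticFunction.cardFactors ((Ψ (i.succAbove k)).eval n).toNat = j' k)).card

/-! ## The statements of the line -/

/-- **Effective cell-parity law for `t` forms** (`LawEffAt t`): the body of
`LeeYangFibres.CellParityLaw` at a fixed number of forms, with the `ε N / log^t N` budget replaced by
`N / (log^t N · (log log N)^B)` for EVERY `B : ℕ`. Strictly between the crux (`B = 1` and
`(log log N)^{-1} ≤ ε` give it back, `CellParityLaw_of`) and the refuted extra-log budget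
(`cellParityLaw_false_logSucc`): the model's own value-scale slip is `O((log L + log log N)/log N)`
relative (refuter audit), far inside. This is the induction hypothesis of the line. -/
def LawEffAt (t : ℕ) : Prop :=
  ∀ (L u B : ℕ), 2 ≤ u → ∃ N₀ : ℕ, ∀ N : ℕ, N₀ ≤ N →
    ∀ Ψ : Fin t → AffLinForm 1, IsNondegenerateSystem Ψ → affLinSize Ψ N ≤ L →
    ∀ K : Set (Fin 1 → ℝ), Convex ℝ K → K ⊆ realBox 1 N →
    ∃ θ : Finset (Fin t) → ℝ, θ ∅ = 1 ∧ (∀ S, |θ S| ≤ 2) ∧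
      ∀ j : Fin t → ℕ, (∀ i, 1 ≤ j i ∧ j i ≤ u) →
        |(cell Ψ K N u j : ℝ) -
            walsh θ j * (archFactor Ψ K * singularProduct Ψ * ∏ i, modelDensity N u (j i))|
          ≤ (N : ℝ) / (Real.log N ^ t * Real.log (Real.log N) ^ B)

/-- **The section atom** (`SectionLevelAt t`, systems of `t + 1 ≥ 2` forms): Bombieri's `(A₂)` for
every coordinate section sequence, with the explicit rough-supported density `sectionDensity`, at
level `N^{1 - (log log N)^{-B}}` and with saving `(log N)^{-A}`, for all `A, B`, uniformly over
systems of size `≤ L`, convex `K ⊆ [-N,N]`, coordinates `i` and frozen cells `j' ∈ [1,u]^t`.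
`t = 1`, `j' = 1`: Elliott–Halberstam for primes in the class `b (mod d)` of one shift `|b| ≤ LN`
(level `x^{1-o(1)}`, inside EH's `x^{1-ε}` regime, above every catalogued Maier /
Friedlander–Granville / Granville–Soundararajan irregularity scale `x·exp(-(log x)^c)`, `x/log^B x`);
`t ≥ 2`: relative equidistribution of prime-tuple-type sets — open at every level (triage X2).
The whole conjectural input of the line. -/
def SectionLevelAt (t : ℕ) : Prop :=
  ∀ (L u A B : ℕ), 2 ≤ u → ∃ N₀ : ℕ, ∀ N : ℕ, N₀ ≤ N →
    ∀ Ψ : Fin (t + 1) → AffLinForm 1, IsNondegenerateSystem Ψ → affLinSize Ψ N ≤ L →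
    ∀ K : Set (Fin 1 → ℝ), Convex ℝ K → K ⊆ realBox 1 N →
    ∀ i : Fin (t + 1), ∀ j' : Fin t → ℕ, (∀ k, 1 ≤ j' k ∧ j' k ≤ u) →
      ∑ d ∈ (Finset.Icc 1 ⌊(N : ℝ) ^ (1 - 1 / Real.log (Real.log N) ^ B)⌋₊).filter Squarefree,
          |(sectionMass Ψ K N u i j' d : ℝ) - sectionDensity Ψ i d * sectionMass Ψ K N u i j' 1|
        ≤ (N : ℝ) / Real.log N ^ A

/-- **The section law** (`SectionLawAt t`, systems of `t + 1` forms): Bombieri's one-parameter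
parity law for every coordinate section — for each `(i, j')` ONE `δ ∈ [0,2]` with
`C_{(m,j')} = (1 + (δ-1)(-1)^m) · a_m · (𝔖(Ψ)/𝔖(Ψ₋ᵢ)) · F⁽ⁱ⁾_{j'} + O(N/(log^{t+1}N (log log N)^B))`
for all `m ∈ [1,u]` (`m` odd: `2-δ`, `m` even: `δ`; parity average pinned to
`H_i F = (𝔖(Ψ)/𝔖(Ψ₋ᵢ)) F`). The engine's output; true in the Hardy–Littlewood world
(`δ = 1`); its top case `m = u` (`a_u = 0`) is the top-cell smallness the crux silently demands. -/
def SectionLawAt (t : ℕ) : Prop :=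
  ∀ (L u B : ℕ), 2 ≤ u → ∃ N₀ : ℕ, ∀ N : ℕ, N₀ ≤ N →
    ∀ Ψ : Fin (t + 1) → AffLinForm 1, IsNondegenerateSystem Ψ → affLinSize Ψ N ≤ L →
    ∀ K : Set (Fin 1 → ℝ), Convex ℝ K → K ⊆ realBox 1 N →
    ∀ i : Fin (t + 1), ∀ j' : Fin t → ℕ, (∀ k, 1 ≤ j' k ∧ j' k ≤ u) →
      ∃ δ : ℝ, 0 ≤ δ ∧ δ ≤ 2 ∧ ∀ m : ℕ, 1 ≤ m → m ≤ u →
        |(cell Ψ K N u (i.insertNth m j') : ℝ) -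
            (1 + (δ - 1) * (-1 : ℝ) ^ m) * modelDensity N u m *
              (singularProduct Ψ / singularProduct (Fin.removeNth i Ψ)) *
                (sectionMass Ψ K N u i j' 1 : ℝ)|
          ≤ (N : ℝ) / (Real.log N ^ (t + 1) * Real.log (Real.log N) ^ B)

/-- **Anatomy of rough integers** (`ModelDensityBounds`): at fixed `u ≥ 2`, for large `N`, every
model density is `≤ C_u / log N`, the bulk ones `a_m`, `1 ≤ m ≤ u-1`, are `≥ c_u / log N`
(`A_m(N) ~ I_m(u) N/log N`, `I_m(u) > 0` iff `m < u`; Chebyshev-level bounds suffice), and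
`a_m = 0` for `m ≥ u` (a product of `u` primes `> N^{1/u}` exceeds `N`). -/
def ModelDensityBounds : Prop :=
  ∀ u : ℕ, 2 ≤ u → ∃ c C : ℝ, 0 < c ∧ 0 < C ∧ ∃ N₀ : ℕ, ∀ N : ℕ, N₀ ≤ N →
    (∀ m : ℕ, modelDensity N u m ≤ C / Real.log N) ∧
    (∀ m : ℕ, 1 ≤ m → m < u → c / Real.log N ≤ modelDensity N u m) ∧
    (∀ m : ℕ, u ≤ m → modelDensity N u m = 0)

/-- **Singular-series bookkeeping** (`SingularRatioBound`): for non-degenerate `(t+1)`-form systems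
of size `≤ L` at scale `N`, both singular products are `≥ 0` (limits of non-negative partial
products, `tendsto_singularProductPartial_holds`) and
`𝔖(Ψ) ≤ C (log log N)^D 𝔖(Ψ₋ᵢ)`: the Euler-factor ratio `(1 - g_{Ψ,i}(p))(1 - 1/p)^{-1}` exceeds `1`
only at primes dividing `a_i ∏_{k ≠ i}(a_i b_k - a_k b_i)` (`≠ 0` by non-degeneracy, `≤ L(2L²N)^t`),
and `n/φ(n) ≪ log log n`. -/
def SingularRatioBound : Prop :=
  ∀ t L : ℕ, ∃ C : ℝ, 0 < C ∧ ∃ D N₀ : ℕ, ∀ N : ℕ, N₀ ≤ N →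
    ∀ Ψ : Fin (t + 1) → AffLinForm 1, IsNondegenerateSystem Ψ → affLinSize Ψ N ≤ L →
    ∀ i : Fin (t + 1),
      0 ≤ singularProduct (Fin.removeNth i Ψ) ∧ 0 ≤ singularProduct Ψ ∧
        singularProduct Ψ ≤ C * Real.log (Real.log N) ^ D * singularProduct (Fin.removeNth i Ψ)

/-- **The Walsh / tensor step** (`WalshStep`): the induction step `t → t + 1` of the line. Given the
anatomy bounds and the singular-series bookkeeping: the section law for `(t+1)`-form systems and
the effective law for `t`-form systems imply the effective law for `(t+1)`-form systems.
Content: (i) `F⁽ⁱ⁾_{j'} = cell (removeNth i Ψ) (K ∩ {ψ_i > 0})`, a `t`-form cell over a convex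
half-body, so the induction hypothesis prices it; (ii) `archFactor (removeNth i Ψ) (K ∩ {ψ_i>0})
= archFactor Ψ K` (same positivity region) and `(𝔖(Ψ)/𝔖(Ψ₋ᵢ))·𝔖(Ψ₋ᵢ) = 𝔖(Ψ)`; (iii) sections
parity-affine in every coordinate ⇒ `C_j = κ_{σ(j)} ∏ a_{j_i} + O(E)` on `[1,u-1]^{t+1}` by
chaining one coordinate at a time (divide by `a_m ≥ c/log N`, multiply back); (iv)
`κ_σ ≈ (1 + σ_i β)·W'(σ')·M` gives Walsh amplitudes with `θ_∅ = 1` EXACTLY and, by positivity of the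
cells when `M ≥ N (log log N)^{-B'}` (else `θ = δ_∅` works), `|θ_S| ≤ 1 + o(1) ≤ 2`; (v) `u = 2`
separately (`C_corner ≤ (2^{t+2} - 2 + o(1)) M a_1^{t+1}`, amplitudes `(ρ-1)/(2^{t+1}-1)`); top
cells from the section law at `m = u`. Loses `(log log N)^{O(1)}`, absorbed by shifting `B`. -/
def WalshStep : Prop :=
  ModelDensityBounds → SingularRatioBound →
    ∀ t : ℕ, 1 ≤ t → SectionLawAt t → LawEffAt t → LawEffAt (t + 1)

/-- **The composition step** (`ComposeStep`; type of the bookkeeping stub `stub_compose`): atom → engine →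
anatomy → bookkeeping → Walsh step → base give the effective law for EVERY number of forms `t ≥ 1`. Pure logic
(induction on `t`); proved below (no `sorry`). -/
def ComposeStep : Prop :=
  (∀ t : ℕ, 1 ≤ t → SectionLevelAt t) → (∀ t : ℕ, 1 ≤ t → SectionLevelAt t → SectionLawAt t) →
    ModelDensityBounds → SingularRatioBound → WalshStep → LawEffAt 1 → ∀ t : ℕ, 1 ≤ t → LawEffAt t

/-! ## Registered stubs -/

/-- ATOM (open; rank-2 difficulty of the line): the tuple-GEH fragment, typed. `t = 1` is an
Elliott–Halberstam statement for shifted rough `Ω`-cells in one residue class (provable today only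
below level `1/2`: Bombieri–Vinogradov / BFI Thm 0 shape); `t ≥ 2` is open at every level
(triage X2/F3). Honours Disproof.lean: keeps `2 ≤ u`, convexity, the box, the size bound and
non-degeneracy (`cellParityLaw_false_without_{twoLeU,convex,box,size,pairwise}`). -/
theorem stub_sectionLevel : ∀ t : ℕ, 1 ≤ t → SectionLevelAt t := by
  sorry

/-- ENGINE (XL, known technology made uniform and effective): Bombieri's asymptotic sieve for the
section sequences — Friedlander–Iwaniec's finite-level form (tree `BombieriSieve.core_finiteLevel`,
`Bombieri1976_asymptotic_sieve_finiteLevel_holds`; relative error `O(δ^{1/3})` from level `x^{1-δ}`,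
here `δ = (log log N)^{-B}`) run with explicit constants for the FAMILY of finite section sequences
(densities `sectionDensity`: dimension one with holes at the primes dividing
`a_i ∏ (a_i b_k - a_k b_i)`, one-sided `Ω(1)`-condition intact), the vector completeness
(`Bombieri1976_asymptotic_sieve_vector_holds`: all `Λ_(k)`, `max k_ν ≥ 2`) and Bombieri's comparison
with `a_n ≡ 1` restricted to `N^{1/u}`-rough integers, which converts `Λ_(k)`-asymptotics into the
`Ω`-cell law with the integers' own densities `a_m` (value-scale slip `O(log log N/log N)` relative,
inside the budget). -/
theorem stub_sectionBombieri : ∀ t : ℕ, 1 ≤ t → SectionLevelAt t → SectionLawAt t := by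
  sorry

/-- ANATOMY (M, provable now): Chebyshev/Mertens-level bounds for `A_m(N)`; `A_m(N) = 0` for
`m ≥ u` is `modelCell_top_eq_zero` of Disproof.lean re-proved. Tree: `RoughNumbersBuchstab.lean`
(`exists_abs_card_roughIcc_sub_buchstab_le`, the total rough count) bounds every `a_m` above. -/
theorem stub_modelDensityBounds : ModelDensityBounds := by
  sorry

/-- BOOKKEEPING (M, provable now): non-negativity of the two singular products and the ratio bound
`𝔖(Ψ) ≤ C (log log N)^D 𝔖(Ψ₋ᵢ)` via `localFactor`, `tendsto_singularProductPartial_holds`,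
`singularProduct_mem_Icc_uniform` and `n/φ(n) ≪ log log n`. -/
theorem stub_singularRatio : SingularRatioBound := by
  sorry

/-- ASSEMBLY (L, provable now; the card's `Reduction₁`, made inductive): tensor flattening + Walsh
inversion with positivity + the half-body / telescoping identities, with the `(log log N)^{O(1)}`
losses absorbed by the effective budgets. Pure bookkeeping over the hypotheses; no number theory
beyond them. -/
theorem stub_walshStep : WalshStep := by
  sorry

/-- BASE (L, provable now): `t = 1` — the `Ω`-cells of the `N^{1/u}`-rough values of ONE progression
segment `{a n + b : n ∈ K ∩ ℤ}` (`|a| ≤ L`, `gcd(a,b) = 1` or everything vanishes) obey the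
one-amplitude law with effective error. With the amplitude `θ_{{0}}` FREE this is Bombieri's theorem
for an interval sequence (level = `|K| ≥ N^{1-o(1)}` or the statement is trivial), so no
short-interval prime number theorem is needed (Disproof.lean's remark concerns `θ = 0`);
alternatively Landau–Selberg–Alladi asymptotics in progressions. -/
theorem stub_base : LawEffAt 1 := by
  sorry

/-! ## Composition (kernel-checked, no `sorry` outside the stubs) -/

/-- **`stub_compose`** (registered bookkeeping stub, PROVED — pure logic of the line): atom → engine →
anatomy → bookkeeping → Walsh step → base give the effective law for EVERY number of forms `t ≥ 1` (induction on
`t` from `t = 1`). The six hypotheses are exactly the statements of the six other registered stubs. -/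
theorem stub_compose : ComposeStep := by
  intro hAtom hEngine hDens hSing hStep hBase t ht
  induction t, ht using Nat.le_induction with
  | base => exact hBase
  | succ t ht ih => exact hStep hDens hSing t ht (hEngine t ht (hAtom t ht)) ih

/-- The line concludes the crux BY NAME: `stub_compose` applied to the six other stubs, then `B = 1` and
`N ≥ exp(exp(1/ε))` turn `N/(log^t N · log log N)` into `ε N / log^t N`. No `Prop` hypotheses; the only
`sorry`s in its closure are the stubs'. -/
theorem CellParityLaw_of :
    Summit.Parity.GeneralizedHardyLittlewood.Theses.LeeYangFibres.CellParityLaw := by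
  have hAll : ∀ t : ℕ, 1 ≤ t → LawEffAt t :=
    stub_compose stub_sectionLevel stub_sectionBombieri stub_modelDensityBounds stub_singularRatio
      stub_walshStep stub_base
  -- weaken the effective budget `B = 1` to `ε`
  intro t L u ht hu ε hε
  obtain ⟨N₀, hN₀⟩ := hAll t ht L u 1 hu
  refine ⟨max N₀ ⌈Real.exp (Real.exp (1 / ε))⌉₊, fun N hN Ψ hΨ hL K hK hKN => ?_⟩
  have hN₀N : N₀ ≤ N := le_trans (le_max_left _ _) hN
  have hN₁N : (⌈Real.exp (Real.exp (1 / ε))⌉₊ : ℝ) ≤ N := by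
    exact_mod_cast le_trans (le_max_right _ _) hN
  have hexpN : Real.exp (Real.exp (1 / ε)) ≤ (N : ℝ) := le_trans (Nat.le_ceil _) hN₁N
  have hlogN : Real.exp (1 / ε) ≤ Real.log N := by
    have := Real.log_le_log (Real.exp_pos _) hexpN
    rwa [Real.log_exp] at this
  have hloglogN : 1 / ε ≤ Real.log (Real.log N) := by
    have := Real.log_le_log (Real.exp_pos _) hlogN
    rwa [Real.log_exp] at this
  have hε' : 0 < 1 / ε := by positivity
  have hlogpos : 0 < Real.log N := lt_of_lt_of_le (Real.exp_pos _) hlogN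
  have hllpos : 0 < Real.log (Real.log N) := lt_of_lt_of_le hε' hloglogN
  obtain ⟨θ, hθ₀, hθS, hθ⟩ := hN₀ N hN₀N Ψ hΨ hL K hK hKN
  refine ⟨θ, hθ₀, hθS, fun j hj => le_trans (hθ j hj) ?_⟩
  have hpow : 0 < Real.log N ^ t := pow_pos hlogpos t
  have hinv : 1 / Real.log (Real.log N) ≤ ε := (one_div_le hllpos hε).mpr hloglogN
  have hNn : 0 ≤ (N : ℝ) / Real.log N ^ t := div_nonneg (Nat.cast_nonneg N) hpow.le
  calc (N : ℝ) / (Real.log N ^ t * Real.log (Real.log N) ^ 1)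
      = (N : ℝ) / Real.log N ^ t * (1 / Real.log (Real.log N)) := by
        rw [pow_one, div_mul_eq_div_div, div_eq_mul_one_div ((N : ℝ) / Real.log N ^ t)]
    _ ≤ (N : ℝ) / Real.log N ^ t * ε := mul_le_mul_of_nonneg_left hinv hNn
    _ = ε * N / Real.log N ^ t := by ring


/-! ## Refuter probes (drefute): identities the Walsh step leans on, typing conventions -/
namespace Probe

/-- removeNth is definitionally the restriction along succAbove. -/
theorem removeNth_apply {t : ℕ} (Ψ : Fin (t + 1) → AffLinForm 1) (i : Fin (t + 1)) (k : Fin t) :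
    Fin.removeNth i Ψ k = Ψ (i.succAbove k) := rfl

/-- insertNth conventions used by `SectionLawAt`. -/
theorem insertNth_same {t : ℕ} (i : Fin (t + 1)) (m : ℕ) (j' : Fin t → ℕ) :
    (i.insertNth m j' : Fin (t + 1) → ℕ) i = m := by
  simp [Fin.insertNth_apply_same]

theorem insertNth_succAbove {t : ℕ} (i : Fin (t + 1)) (m : ℕ) (j' : Fin t → ℕ) (k : Fin t) :
    (i.insertNth m j' : Fin (t + 1) → ℕ) (i.succAbove k) = j' k := by
  simp [Fin.insertNth_apply_succAbove]

/-- (i) of the Walsh step: the fibre mass at `d = 1` IS the joint cell of the subsystem over the half-body. -/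
theorem sectionMass_one_eq_cell {t : ℕ} (Ψ : Fin (t + 1) → AffLinForm 1) (K : Set (Fin 1 → ℝ)) (N u : ℕ)
    (i : Fin (t + 1)) (j' : Fin t → ℕ) :
    sectionMass Ψ K N u i j' 1 = cell (Fin.removeNth i Ψ) (K ∩ {x | 0 < (Ψ i).realEval x}) N u j' := by
  unfold sectionMass cell
  congr 1
  ext n
  have hcast : (Ψ i).realEval (realPoint n) = (((Ψ i).eval n : ℤ) : ℝ) :=
    AffLinForm.realEval_intCast (Ψ i) n
  simp only [Finset.mem_filter, Set.mem_inter_iff, Set.mem_setOf_eq, hcast, Int.cast_pos, Nat.cast_one,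
    one_dvd, true_and, Fin.removeNth]
  tauto

/-- (ii) of the Walsh step: same positivity region, same archimedean factor. -/
theorem archFactor_removeNth {t : ℕ} (Ψ : Fin (t + 1) → AffLinForm 1) (K : Set (Fin 1 → ℝ)) (i : Fin (t + 1)) :
    archFactor (Fin.removeNth i Ψ) (K ∩ {x | 0 < (Ψ i).realEval x}) = archFactor Ψ K := by
  unfold archFactor
  congr 2
  ext x
  simp only [Set.mem_inter_iff, Set.mem_setOf_eq, Fin.removeNth]
  rw [Fin.forall_iff_succAbove i]
  tauto

/-- size of the subsystem does not exceed the size of the system. -/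
theorem affLinSize_removeNth_le {t : ℕ} (Ψ : Fin (t + 1) → AffLinForm 1) (i : Fin (t + 1)) (N : ℝ) :
    affLinSize (Fin.removeNth i Ψ) N ≤ affLinSize Ψ N := by
  unfold affLinSize
  rw [Fin.sum_univ_succAbove (fun k => ∑ j, |(((Ψ k).coeff j : ℤ) : ℝ)|) i,
    Fin.sum_univ_succAbove (fun k => |((Ψ k).const : ℝ) / N|) i]
  simp only [Fin.removeNth]
  have h1 : 0 ≤ ∑ j, |(((Ψ i).coeff j : ℤ) : ℝ)| := Finset.sum_nonneg (fun _ _ => abs_nonneg _)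
  have h2 : 0 ≤ |((Ψ i).const : ℝ) / N| := abs_nonneg _
  linarith

/-- non-degeneracy passes to subsystems. -/
theorem isNondegenerateSystem_removeNth {t : ℕ} (Ψ : Fin (t + 1) → AffLinForm 1) (i : Fin (t + 1))
    (h : IsNondegenerateSystem Ψ) : IsNondegenerateSystem (Fin.removeNth i Ψ) := by
  refine ⟨fun k => h.1 _, fun k l hkl a b hab => h.2 _ _ ?_ a b hab⟩
  exact fun heq => hkl (Fin.succAbove_right_injective heq)

/-- the half-body is convex. -/
theorem convex_halfBody {t : ℕ} (Ψ : Fin (t + 1) → AffLinForm 1) (K : Set (Fin 1 → ℝ)) (i : Fin (t + 1))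
    (hK : Convex ℝ K) : Convex ℝ (K ∩ {x | 0 < (Ψ i).realEval x}) := by
  apply hK.inter
  intro x hx y hy a b ha hb hab
  simp only [Set.mem_setOf_eq] at hx hy ⊢
  have key : (Ψ i).realEval (a • x + b • y) = a * (Ψ i).realEval x + b * (Ψ i).realEval y := by
    simp only [AffLinForm.realEval, Fin.sum_univ_one, Pi.add_apply, Pi.smul_apply, smul_eq_mul]
    linear_combination (-((Ψ i).const : ℝ)) * hab
  rw [key]
  rcases ha.lt_or_eq with ha' | rfl
  · have h1 := mul_pos ha' hx
    have h2 := mul_nonneg hb hy.le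
    linarith
  · simp only [zero_add] at hab
    subst hab
    simpa using hy

/-- t = 0 case of `SingularRatioBound`: the empty system has all local factors equal to 1. -/
theorem localFactor_fin0 (Ψ : Fin 0 → AffLinForm 1) (q : ℕ) (hq : 0 < q) : localFactor Ψ q = 1 := by
  unfold localFactor
  simp only [Finset.univ_eq_empty, Finset.prod_empty, Finset.sum_const, Fintype.card_piFinset,
    Finset.card_range, Finset.prod_const, Finset.card_univ, Fintype.card_fin, nsmul_eq_mul, mul_one, pow_one]
  have hq' : (q : ℝ) ≠ 0 := by exact_mod_cast hq.ne'
  field_simp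

end Probe

end Summit.Parity.GeneralizedHardyLittlewood.Cruxes.CellParityLaw.DrefuteProbe

end
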